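import Summits.QuantumFields.YangMills.Theorems.BalabanUVNodesK2EndOfChain190OwnDrift

/-!
# Crux K2⁷ `EndpointGivenBR13SepCoPH` (stmt-QuantumFields-20543) — THE OWN-DRIFT PAIR {2ᴼᴰ, 1ᴼᴿ} (plan g83 WORDS-4 booking (β3), question (q-K2-3)): the κ-free road of
# `BalabanUVNodesK2EndOfChain190OwnDrift` (p606097) CUT IN TWO along the DRIFT letter, texts INLINE at v6's full-prefix keying, `bOwn` keyed DEF-FREE as the datum's
# ZERO-HISTORY VALUES `k ↦ β_{k+1}(0⃗)`; the concluder BY NAME; the row-D4 socket serves 1ᴼᴿ's run rows (hypothesis form; 0 `def`, 0 `sorry`)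

Cell pub-balaban (b2b), seat `b2b-balaban-beta-an4` (BINDER row D4 OWNER), gen 152.  Helper for crux K2⁷ = stmt-QuantumFields-20543 (`--supports … --as helper`); count-neutral;
NO skeleton is registered by this file — the cut, the keying of `bOwn` (def-free here; a one-line `abbrev` beside `Node00.betaOfRecord₁₃` is def-T ∕ DEF-1's pen) and the
registration are the PLAN's (plan g83 I.29644: «A YES with the def's path is trigger (β3)»).  This file only makes the two texts and their sorry-free composition AVAILABLE
IN THE TREE BY NAME, PORT-1 style.

`bOwn` IS FORCED (no new object).  Every one-loop split `Sβ` of ANY `β : HBeta` has `Sβ.β0 k = β k 0⃗` (`split_β0_eq_apply_zero`, CRIT-2's Negative lane; here as the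
function identity `split_β0_eq_zeroHistoryValues`); at the Stage-13 datum this is the one-loop number of record `beta0OfMerged (β_merged₁₃ θ) θ.v₀`
(`…N26AtRecord13.β0_split_betaOfRecord₁₃_eq`, `oneLoopSplit_unique` — cited, not imported).  So «NODE O's own one-loop numbers» = `fun k => D.βfun k (fun _ => 0)`,
`D := Node00.datumOfRecord₁₃SepCoPH F 2 θ hP`, and the row-D4 socket `ChainTFac190H 4 M μ ν Sβ γ₀ c ℓ α₂ q` (typed over a split) already speaks about exactly them.

THE CUT (drift-keyed; mirror image of v6's anchor-keying; print's order of quantifiers — the one-loop slope first, the thresholds after, [I] Thm 3 p. 264):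
* 2ᴼᴰ «OWN DRIFT»: prefix → `∃ s A, 0 < s ∧ OneLoopDrift s A bOwn` — row (D1) + the asymptotic-freedom SIGN at NODE O's own numbers (β-cell ∕ CAP content at NODE O's kernels,
  κ-free; NOT at a colour table).
* 1ᴼᴿ «OWN RUN ROWS, GIVEN THE DRIFT»: prefix → `∀ s A, 0 < s → OneLoopDrift s A bOwn → ∃ M μ ν c ℓ α₂ q γ₀, run rows relative to bOwn ∧ CondsL ∧ R22gen ∧ Valid ∧ SignsL ∧
  0 < γ₀ ∧ ε₁·K_rem,L ≤ s ∧ SurvCont` — NODE O's wall (the (190)-chain along the in-window runs with the second-moment representation), the CAP against the given slope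
  INSIDE the NODE-O text (DECISION-204: at a fixed admissible tuple the chain's ε₁ is the tuple's own; the cap is where print's smallness lives), (C) on survivors.
`EndpointGivenBR13SepCoPH_of_ownDriftK_ownRunRowsK : 2ᴼᴰ → 1ᴼᴿ → …Theses.BalabanUVNodes.EndpointGivenBR13SepCoPH` = p606097's one-text concluder after one `obtain`
(`ownDriftRunChain190K_of_ownPairK`: the pair ⟹ the one text).  §3: a `ChainTFac190H` inhabitant for any split of the datum's β (+ (C-pt), side conditions, cap) serves 1ᴼᴿ's
body at its tuple (`ownRunRows_of_chainTFac190H`) — the row-D4 socket of record IS the supplier shape of 1ᴼᴿ, read along runs.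

HONEST FRAMING.  Implications between displayed HYPOTHESIS SHAPES and elementary bookkeeping; NOTHING of Bałaban's analysis is asserted or discharged: 2ᴼᴰ (the drift of the
record's own one-loop numbers — their history-independence, sign and size are NODE O's ∕ the β-cell's theorems, never the definer's: `Node00/BetaOfRecord` :190) and 1ᴼᴿ (the
leaves at the record's run histories, numerics with the cap, (C) on survivors) are hypotheses inhabited at no θ here (instance 0∕1); (D4) NOT discharged; K2⁷ ∕ its two registered
stubs NOT proved (v6 5a75a2378c79b303 STANDS: 2 registered, 0 closed); counts unmoved; `bOwn` = the v₀-FACE numbers (the object of `Negative/Anchor13FalseOfTwoBaseHistories`; no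
corner ∕ anchor statement is made about them here); [Balaban1987RG1] Thm 2 + (0.31) p. 259 is UNPROVED IN PRINT; route R4 closes the CONDITIONAL finite-𝕋⁴ rung `BalabanLadder.UV`
only — NOT the continuum limit, NOT ℝ⁴, NOT OS, NOT the Yang–Mills mass gap, NOT Clay.  No `def`, no `instance`, no `notation`, no `axiom`.  Sources (context only; nothing
printed is used as a hypothesis): [I] = [Balaban1987RG1] CMP **109** (1987): Thm 2 p. 259 (first sentence), Thm 3 p. 264, (1.20)–(1.22) p. 264, (2.12)–(2.14) p. 268, (5.10)
p. 293; [II] = [Balaban1988RG2Cluster] CMP **116** (1988): Lemma 3 (2.38) p. 20.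
-/

noncomputable section

namespace Summit.QuantumFields.YangMills.Theorems.BalabanUVNodesK2OwnDriftPair

open Literature.MathematicalPhysics.QuantumFieldTheory.Balaban1983to89
open Literature.MathematicalPhysics.QuantumFieldTheory.Balaban1983to89.FlowStep
open Literature.MathematicalPhysics.QuantumFieldTheory.Balaban1983to89.B12Beta (HistBox OneLoopSplit)
open Literature.MathematicalPhysics.QuantumFieldTheory.Balaban1983to89.B13ScaleTransfer (Pt)
open Literature.MathematicalPhysics.QuantumFieldTheory.Balaban1983to89.DagBinding (EndpointExistence)
open Literature.MathematicalPhysics.QuantumFieldTheory.Balaban1983to89.T4Continuum (T4Family)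
open Literature.MathematicalPhysics.QuantumFieldTheory.Balaban1983to89.Beta.Drift (OneLoopDrift)
open Literature.MathematicalPhysics.QuantumFieldTheory.Balaban1983to89.Beta.RemainderChainLattice
open Literature.MathematicalPhysics.QuantumFieldTheory.Balaban1983to89.Beta.RemainderLimitTorus (LDom limKernel)
open Literature.MathematicalPhysics.QuantumFieldTheory.Balaban1983to89.Beta.RemainderLocalityHolo
open Literature.MathematicalPhysics.QuantumFieldTheory.Balaban1983to89.Beta.RemainderDecay190
open Literature.MathematicalPhysics.QuantumFieldTheory.Balaban1983to89.Beta.RemainderDecay190HoloChain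
open Summit.QuantumFields.BalabanUV.Gaps.BetaContFromD4Chain (CPt betaContH_of_chainTFac190H)
open Summit.QuantumFields.YangMills.Theorems.BalabanUVNodesK2NamedJetsRunRemAt (SurvCont SurvCont.of_betaContH)
open Summit.QuantumFields.YangMills.Theorems.BalabanUVNodesK2RunRemAtOfChain190 (boxLeaves190H_of_chainTFac190H runLeaves190H_of_boxLeaves190H)
open Summit.QuantumFields.YangMills.Theorems.BalabanUVNodesK2EndOfChain190OwnDrift
  (endpointExistence_of_runLeaves190H_ownDrift EndpointGivenBR13SepCoPH_of_ownDriftRunChain190K)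
open Summit.QuantumFields.YangMills.Theorems.EndpointGivenBR13SepCoPH.Negative.Anchor13FalseOfTwoBaseHistories (split_β0_eq_apply_zero)

/-! ## §0 `bOwn` is forced: every split's one-loop numbers ARE the zero-history values of `β` -/

/-- **EVERY SPLIT's ONE-LOOP NUMBERS ARE `k ↦ β_{k+1}(0⃗)`** (as a function identity; `split_β0_eq_apply_zero` BY NAME): the def-free keying of «NODE O's own numbers».  At the
Stage-13 datum these are the one-loop numbers of record `beta0OfMerged (β_merged₁₃ θ) θ.v₀` (`…N26AtRecord13.β0_split_betaOfRecord₁₃_eq`). [cite: Balaban1987RG1, (2.12)-(2.14) p.268] -/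
theorem split_β0_eq_zeroHistoryValues {β : HBeta} (Sβ : OneLoopSplit β) : Sβ.β0 = fun k => β k (fun _ => 0) :=
  funext fun k => split_β0_eq_apply_zero Sβ k

/-! ## §1 At the record: the pair's bodies ⟹ endpoint existence -/

section Record

variable (F : T4Family) (θ : Node00.Stage13HParams F 2) (hP : θ.Provisos₁₃SepCoPH F 2)

/-- **★ POINTWISE COMPOSITION OF THE PAIR**: 2ᴼᴰ's body (a positive-slope drift of the datum's zero-history values) and 1ᴼᴿ's body (given that drift: run rows relative to the
same values, side conditions, `0 < γ₀`, the cap against the slope, (C) on survivors) ⟹ `EndpointExistence D.C.toB12` (p606097's `endpointExistence_of_runLeaves190H_ownDrift`).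
[cite: Balaban1987RG1, Thm 2 p.259 (first sentence), Thm 3 p.264, (2.12)-(2.14) p.268 and (5.10) p.293; Balaban1988RG2Cluster, Lemma 3 (2.38) p.20] -/
theorem endpointExistence_of_ownDrift_ownRunRows
    (hD : ∃ s A : ℝ, 0 < s ∧ OneLoopDrift s A (fun k => (Node00.datumOfRecord₁₃SepCoPH F 2 θ hP).βfun k (fun _ => 0)))
    (hR : ∀ s A : ℝ, 0 < s → OneLoopDrift s A (fun k => (Node00.datumOfRecord₁₃SepCoPH F 2 θ hP).βfun k (fun _ => 0)) →
      ∃ (M : ℕ) (_ : NeZero M) (μ ν : Fin 4) (c : B13.Consts) (ℓ α₂ : ℝ) (q : Consts190) (γ₀ : ℝ),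
        (∀ (n : ℕ) (gs : ℕ → ℝ), RGEqH n (Node00.datumOfRecord₁₃SepCoPH F 2 θ hP).βfun gs → Step.InInterval γ₀ n gs → ∀ k, k ≤ n →
          ∃ a : LDom 4 → Pt 4 → ℝ, (Node00.datumOfRecord₁₃SepCoPH F 2 θ hP).βfun k (prefixOf gs k) -
              (Node00.datumOfRecord₁₃SepCoPH F 2 θ hP).βfun k (fun _ => 0) =
            B12Beta.secondMoment (fun _ _ => limKernel a) μ ν ∧ Nonempty (PolLeavesTFac190H 4 M a c ℓ α₂ q)) ∧
        CondsL 4 c ℓ ∧ c.R22gen ℓ ∧ q.Valid c.δ₀ ∧ SignsL c α₂ q.B₃ ∧ 0 < γ₀ ∧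
        c.ε₁ * remCoeffL 4 M c α₂ q.B₃ ≤ s ∧ SurvCont (Node00.datumOfRecord₁₃SepCoPH F 2 θ hP).βfun γ₀) :
    EndpointExistence (Node00.datumOfRecord₁₃SepCoPH F 2 θ hP).C.toB12 := by
  obtain ⟨s, A, hs0, hdrift⟩ := hD
  obtain ⟨M, instM, μ, ν, c, ℓ, α₂, q, γ₀, hrun, hC, h22, hq, hs, hγ₀, hcap, hcont⟩ := hR s A hs0 hdrift
  exact endpointExistence_of_runLeaves190H_ownDrift F θ hP hrun hC h22 hq hs hγ₀ hdrift hcap hcont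

end Record

/-! ## §2 The two texts INLINE at v6's full-prefix keying ⟹ the one text of p606097 ⟹ the crux decl BY NAME -/

section Keyed

/-- **THE PAIR ⟹ THE ONE TEXT** of `…K2EndOfChain190OwnDrift` (take `b := bOwn`, `obtain` the slope from 2ᴼᴰ, feed 1ᴼᴿ). [folklore] -/
theorem ownDriftRunChain190K_of_ownPairK
    (hD : ∀ (F : T4Family) (θ : Node00.Stage13HParams F 2) (hP : θ.Provisos₁₃SepCoPH F 2),
      (θ.ZhUnity F 2 ∧ θ.SlotsNondegenerate₁₃ F 2) → θ.Admissible F 2 →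
      B16.EndStatementBPrinted (Node00.datumOfRecord₁₃SepCoPH F 2 θ hP).C →
      (∃ γ₁ : ℝ, 0 < γ₁ ∧ ∀ γ : ℝ, 0 < γ → γ ≤ γ₁ →
        ∃ P : B12.RunParams, 1 ≤ P.K ∧ ((Node00.datumOfRecord₁₃SepCoPH F 2 θ hP).C P).flow.InInterval γ P.K) →
      ∃ s A : ℝ, 0 < s ∧ OneLoopDrift s A (fun k => (Node00.datumOfRecord₁₃SepCoPH F 2 θ hP).βfun k (fun _ => 0)))
    (hR : ∀ (F : T4Family) (θ : Node00.Stage13HParams F 2) (hP : θ.Provisos₁₃SepCoPH F 2),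
      (θ.ZhUnity F 2 ∧ θ.SlotsNondegenerate₁₃ F 2) → θ.Admissible F 2 →
      B16.EndStatementBPrinted (Node00.datumOfRecord₁₃SepCoPH F 2 θ hP).C →
      (∃ γ₁ : ℝ, 0 < γ₁ ∧ ∀ γ : ℝ, 0 < γ → γ ≤ γ₁ →
        ∃ P : B12.RunParams, 1 ≤ P.K ∧ ((Node00.datumOfRecord₁₃SepCoPH F 2 θ hP).C P).flow.InInterval γ P.K) →
      ∀ s A : ℝ, 0 < s → OneLoopDrift s A (fun k => (Node00.datumOfRecord₁₃SepCoPH F 2 θ hP).βfun k (fun _ => 0)) →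
      ∃ (M : ℕ) (_ : NeZero M) (μ ν : Fin 4) (c : B13.Consts) (ℓ α₂ : ℝ) (q : Consts190) (γ₀ : ℝ),
        (∀ (n : ℕ) (gs : ℕ → ℝ), RGEqH n (Node00.datumOfRecord₁₃SepCoPH F 2 θ hP).βfun gs → Step.InInterval γ₀ n gs → ∀ k, k ≤ n →
          ∃ a : LDom 4 → Pt 4 → ℝ, (Node00.datumOfRecord₁₃SepCoPH F 2 θ hP).βfun k (prefixOf gs k) -
              (Node00.datumOfRecord₁₃SepCoPH F 2 θ hP).βfun k (fun _ => 0) =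
            B12Beta.secondMoment (fun _ _ => limKernel a) μ ν ∧ Nonempty (PolLeavesTFac190H 4 M a c ℓ α₂ q)) ∧
        CondsL 4 c ℓ ∧ c.R22gen ℓ ∧ q.Valid c.δ₀ ∧ SignsL c α₂ q.B₃ ∧ 0 < γ₀ ∧
        c.ε₁ * remCoeffL 4 M c α₂ q.B₃ ≤ s ∧ SurvCont (Node00.datumOfRecord₁₃SepCoPH F 2 θ hP).βfun γ₀) :
    ∀ (F : T4Family) (θ : Node00.Stage13HParams F 2) (hP : θ.Provisos₁₃SepCoPH F 2),
      (θ.ZhUnity F 2 ∧ θ.SlotsNondegenerate₁₃ F 2) → θ.Admissible F 2 →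
      B16.EndStatementBPrinted (Node00.datumOfRecord₁₃SepCoPH F 2 θ hP).C →
      (∃ γ₁ : ℝ, 0 < γ₁ ∧ ∀ γ : ℝ, 0 < γ → γ ≤ γ₁ →
        ∃ P : B12.RunParams, 1 ≤ P.K ∧ ((Node00.datumOfRecord₁₃SepCoPH F 2 θ hP).C P).flow.InInterval γ P.K) →
      ∃ (b : ℕ → ℝ) (s A : ℝ) (M : ℕ) (_ : NeZero M) (μ ν : Fin 4) (c : B13.Consts) (ℓ α₂ : ℝ) (q : Consts190) (γ₀ : ℝ),
        (∀ (n : ℕ) (gs : ℕ → ℝ), RGEqH n (Node00.datumOfRecord₁₃SepCoPH F 2 θ hP).βfun gs → Step.InInterval γ₀ n gs → ∀ k, k ≤ n →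
          ∃ a : LDom 4 → Pt 4 → ℝ, (Node00.datumOfRecord₁₃SepCoPH F 2 θ hP).βfun k (prefixOf gs k) - b k =
            B12Beta.secondMoment (fun _ _ => limKernel a) μ ν ∧ Nonempty (PolLeavesTFac190H 4 M a c ℓ α₂ q)) ∧
        CondsL 4 c ℓ ∧ c.R22gen ℓ ∧ q.Valid c.δ₀ ∧ SignsL c α₂ q.B₃ ∧ 0 < γ₀ ∧
        c.ε₁ * remCoeffL 4 M c α₂ q.B₃ ≤ s ∧ OneLoopDrift s A b ∧
        SurvCont (Node00.datumOfRecord₁₃SepCoPH F 2 θ hP).βfun γ₀ := by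
  intro F θ hP hU hθ hB hwin
  obtain ⟨s, A, hs0, hdrift⟩ := hD F θ hP hU hθ hB hwin
  obtain ⟨M, instM, μ, ν, c, ℓ, α₂, q, γ₀, hrun, hC, h22, hq, hs, hγ₀, hcap, hcont⟩ := hR F θ hP hU hθ hB hwin s A hs0 hdrift
  exact ⟨fun k => (Node00.datumOfRecord₁₃SepCoPH F 2 θ hP).βfun k (fun _ => 0), s, A, M, instM, μ, ν, c, ℓ, α₂, q, γ₀,
    hrun, hC, h22, hq, hs, hγ₀, hcap, hdrift, hcont⟩

/-- **★★★ THE OWN-DRIFT PAIR ⟹ THE CRUX DECL BY NAME** (`hD` = 2ᴼᴰ «own drift», `hR` = 1ᴼᴿ «own run rows given the drift», both INLINE at v6's keying; p606097's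
`EndpointGivenBR13SepCoPH_of_ownDriftRunChain190K` ∘ `ownDriftRunChain190K_of_ownPairK`).  `exact EndpointGivenBR13SepCoPH_of_ownDriftK_ownRunRowsK stub_ownDrift13 stub_ownRunRows13`
would close K2⁷ modulo two such registered stubs — the registration is the plan's.  CONDITIONAL; K2⁷ NOT closed; instance 0∕1.
[cite: Balaban1987RG1, Thm 2 p.259 (first sentence), Thm 3 p.264, (2.12)-(2.14) p.268 and (5.10) p.293; Balaban1988RG2Cluster, Lemma 3 (2.38) p.20] -/
theorem EndpointGivenBR13SepCoPH_of_ownDriftK_ownRunRowsK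
    (hD : ∀ (F : T4Family) (θ : Node00.Stage13HParams F 2) (hP : θ.Provisos₁₃SepCoPH F 2),
      (θ.ZhUnity F 2 ∧ θ.SlotsNondegenerate₁₃ F 2) → θ.Admissible F 2 →
      B16.EndStatementBPrinted (Node00.datumOfRecord₁₃SepCoPH F 2 θ hP).C →
      (∃ γ₁ : ℝ, 0 < γ₁ ∧ ∀ γ : ℝ, 0 < γ → γ ≤ γ₁ →
        ∃ P : B12.RunParams, 1 ≤ P.K ∧ ((Node00.datumOfRecord₁₃SepCoPH F 2 θ hP).C P).flow.InInterval γ P.K) →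
      ∃ s A : ℝ, 0 < s ∧ OneLoopDrift s A (fun k => (Node00.datumOfRecord₁₃SepCoPH F 2 θ hP).βfun k (fun _ => 0)))
    (hR : ∀ (F : T4Family) (θ : Node00.Stage13HParams F 2) (hP : θ.Provisos₁₃SepCoPH F 2),
      (θ.ZhUnity F 2 ∧ θ.SlotsNondegenerate₁₃ F 2) → θ.Admissible F 2 →
      B16.EndStatementBPrinted (Node00.datumOfRecord₁₃SepCoPH F 2 θ hP).C →
      (∃ γ₁ : ℝ, 0 < γ₁ ∧ ∀ γ : ℝ, 0 < γ → γ ≤ γ₁ →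
        ∃ P : B12.RunParams, 1 ≤ P.K ∧ ((Node00.datumOfRecord₁₃SepCoPH F 2 θ hP).C P).flow.InInterval γ P.K) →
      ∀ s A : ℝ, 0 < s → OneLoopDrift s A (fun k => (Node00.datumOfRecord₁₃SepCoPH F 2 θ hP).βfun k (fun _ => 0)) →
      ∃ (M : ℕ) (_ : NeZero M) (μ ν : Fin 4) (c : B13.Consts) (ℓ α₂ : ℝ) (q : Consts190) (γ₀ : ℝ),
        (∀ (n : ℕ) (gs : ℕ → ℝ), RGEqH n (Node00.datumOfRecord₁₃SepCoPH F 2 θ hP).βfun gs → Step.InInterval γ₀ n gs → ∀ k, k ≤ n →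
          ∃ a : LDom 4 → Pt 4 → ℝ, (Node00.datumOfRecord₁₃SepCoPH F 2 θ hP).βfun k (prefixOf gs k) -
              (Node00.datumOfRecord₁₃SepCoPH F 2 θ hP).βfun k (fun _ => 0) =
            B12Beta.secondMoment (fun _ _ => limKernel a) μ ν ∧ Nonempty (PolLeavesTFac190H 4 M a c ℓ α₂ q)) ∧
        CondsL 4 c ℓ ∧ c.R22gen ℓ ∧ q.Valid c.δ₀ ∧ SignsL c α₂ q.B₃ ∧ 0 < γ₀ ∧
        c.ε₁ * remCoeffL 4 M c α₂ q.B₃ ≤ s ∧ SurvCont (Node00.datumOfRecord₁₃SepCoPH F 2 θ hP).βfun γ₀) :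
    Summit.QuantumFields.YangMills.Theses.BalabanUVNodes.EndpointGivenBR13SepCoPH :=
  EndpointGivenBR13SepCoPH_of_ownDriftRunChain190K (ownDriftRunChain190K_of_ownPairK hD hR)

end Keyed

/-! ## §3 The row-D4 socket of record serves 1ᴼᴿ's run rows (any split; the split's numbers ARE `bOwn`) -/

section Socket

variable (F : T4Family) (θ : Node00.Stage13HParams F 2) (hP : θ.Provisos₁₃SepCoPH F 2)
variable {M : ℕ} [NeZero M] {μ ν : Fin 4} {c : B13.Consts} {ℓ α₂ : ℝ} {q : Consts190} {γ₀ : ℝ}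

/-- **THE ROW-D4 SOCKET ⟹ 1ᴼᴿ's RUN ROWS RELATIVE TO `bOwn`**: a `ChainTFac190H` inhabitant for ANY split of the datum's β supplies, at every in-window run prefix, the kernel with
the second-moment representation of `β_{k+1}(prefix) − β_{k+1}(0⃗)` and its leaves (`boxLeaves190H_of_chainTFac190H` read through `split_β0_eq_zeroHistoryValues`, restricted to runs).
[cite: Balaban1987RG1, (1.20)-(1.22) p.264, (2.12)-(2.14) p.268 and (5.10) p.293; Balaban1988RG2Cluster, Lemma 3 (2.38) p.20] -/
theorem ownRunRows_of_chainTFac190H (Sβ : OneLoopSplit (Node00.datumOfRecord₁₃SepCoPH F 2 θ hP).βfun)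
    (R : ChainTFac190H 4 M μ ν Sβ γ₀ c ℓ α₂ q) :
    ∀ (n : ℕ) (gs : ℕ → ℝ), RGEqH n (Node00.datumOfRecord₁₃SepCoPH F 2 θ hP).βfun gs → Step.InInterval γ₀ n gs → ∀ k, k ≤ n →
      ∃ a : LDom 4 → Pt 4 → ℝ, (Node00.datumOfRecord₁₃SepCoPH F 2 θ hP).βfun k (prefixOf gs k) -
          (Node00.datumOfRecord₁₃SepCoPH F 2 θ hP).βfun k (fun _ => 0) =
        B12Beta.secondMoment (fun _ _ => limKernel a) μ ν ∧ Nonempty (PolLeavesTFac190H 4 M a c ℓ α₂ q) := by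
  have h := runLeaves190H_of_boxLeaves190H (boxLeaves190H_of_chainTFac190H R)
  rw [split_β0_eq_zeroHistoryValues Sβ] at h
  exact h

/-- **★ THE ROW-D4 SOCKET + (C-pt) + THE CAP AGAINST A GIVEN SLOPE ⟹ 1ᴼᴿ's BODY AT ITS TUPLE** (box level `0 < γ₀`; (C) on the box DERIVED from (C-pt), then read on survivors):
what NODE O owes for 1ᴼᴿ on print's road, in the socket currency of `HOME/b2b-balaban-beta-an4/D4-INSTANCE-LINKS.md`. [cite: Balaban1987RG1, (1.20)-(1.22) p.264, (4.4) p.281 and (5.10) p.293; Balaban1988RG2Cluster, Lemma 3 (2.38) p.20] -/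
theorem ownRunRowsBody_of_chainTFac190H (Sβ : OneLoopSplit (Node00.datumOfRecord₁₃SepCoPH F 2 θ hP).βfun)
    (R : ChainTFac190H 4 M μ ν Sβ γ₀ c ℓ α₂ q) (hcpt : CPt R) (hC : CondsL 4 c ℓ) (h22 : c.R22gen ℓ) (hq : q.Valid c.δ₀)
    (hs : SignsL c α₂ q.B₃) (hγ₀ : 0 < γ₀) {s : ℝ} (hcap : c.ε₁ * remCoeffL 4 M c α₂ q.B₃ ≤ s) :
    ∃ (M : ℕ) (_ : NeZero M) (μ ν : Fin 4) (c : B13.Consts) (ℓ α₂ : ℝ) (q : Consts190) (γ₀ : ℝ),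
      (∀ (n : ℕ) (gs : ℕ → ℝ), RGEqH n (Node00.datumOfRecord₁₃SepCoPH F 2 θ hP).βfun gs → Step.InInterval γ₀ n gs → ∀ k, k ≤ n →
        ∃ a : LDom 4 → Pt 4 → ℝ, (Node00.datumOfRecord₁₃SepCoPH F 2 θ hP).βfun k (prefixOf gs k) -
            (Node00.datumOfRecord₁₃SepCoPH F 2 θ hP).βfun k (fun _ => 0) =
          B12Beta.secondMoment (fun _ _ => limKernel a) μ ν ∧ Nonempty (PolLeavesTFac190H 4 M a c ℓ α₂ q)) ∧
      CondsL 4 c ℓ ∧ c.R22gen ℓ ∧ q.Valid c.δ₀ ∧ SignsL c α₂ q.B₃ ∧ 0 < γ₀ ∧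
      c.ε₁ * remCoeffL 4 M c α₂ q.B₃ ≤ s ∧ SurvCont (Node00.datumOfRecord₁₃SepCoPH F 2 θ hP).βfun γ₀ :=
  ⟨M, inferInstance, μ, ν, c, ℓ, α₂, q, γ₀, ownRunRows_of_chainTFac190H F θ hP Sβ R, hC, h22, hq, hs, hγ₀, hcap,
    SurvCont.of_betaContH hγ₀ (betaContH_of_chainTFac190H R hC h22 hq hs (by norm_num) hcpt)⟩

end Socket

end Summit.QuantumFields.YangMills.Theorems.BalabanUVNodesK2OwnDriftPair

end
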